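import Mathlib.GroupTheory.Sylow
import Mathlib.Data.Nat.Factorization.Basic
import Mathlib.Tactic.NoncommRing
import Literature.NumberTheory.Automorphic.DefiniteOrderUnitsTorsion
import HarnessLib

/-!
# Unit groups of definite quaternion orders over `ℚ` have order dividing `24`; the Brandt
# weights divide `12`

Topic `NumberTheory/Automorphic`; theorems only (no definition, no named fact, no instance).
Let `D` be a totally definite quaternion algebra over `ℚ` and `I ⊆ D` a full `ℤ`-lattice. The unit
group `O_L(I)ˣ = Stab_{Dˣ}(I)` of its left order is finite (`finite_units_leftOrder`,
`DefiniteOrderUnitsFinite.lean`) and its elements have order dividing `12`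
(`Brandt.orderOf_dvd_twelve_of_mem_stabilizer`, `DefiniteOrderUnitsTorsion.lean`). Here we add the
Sylow bookkeeping:

* `natCard_dvd_twentyfour_of_pow_twelve` — **a finite subgroup `G` of the unit group of a ring
  without zero divisors all of whose elements satisfy `g¹² = 1` has order dividing `24`.** By
  Cauchy only `2` and `3` divide `#G`. A subgroup of order `9` is commutative of exponent `3`; two
  commuting cube roots of unity `x, y ≠ 1` satisfy `(y − x)(y − x²) = 0`, so such a subgroup has at
  most `3` elements (`natCard_le_three_of_pow_three`, `natCard_ne_nine_of_pow_twelve`). A subgroup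
  of order `16` has exponent `4`; its elements are `±1` or square roots of `−1`
  (`eq_or_eq_neg_or_sq_of_pow_four`), two square roots of `−1` in it agree up to sign or
  anticommute (`anticomm_of_sq_eq_neg_one`), and a third one anticommuting with `x` and `y`
  commutes with `xy` and is therefore `±xy`: at most `8` elements (`natCard_le_eight_of_pow_four`).
* `Brandt.card_stabilizer_dvd_twentyfour` — **`#O_L(I)ˣ ∣ 24`**; hence
  `Brandt.unitIndex_leftOrder_dvd_twelve` (`#O_L(I)ˣ / 2 ∣ 12`), `Brandt.weight_dvd_twelve` and
  `Brandt.XiSetup.weight_dvd_twelve`: **the Brandt weights `w_c = #O_L(I_c)ˣ / 2` divide `12`**.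

This is the classical list of unit groups of definite `ℤ`-orders (cyclic of order `2, 4, 6`,
dicyclic of order `8, 12`, binary tetrahedral of order `24`; Vignéras 1980 Ch. V, Voight 2021
chs. 11 and 32) in the weak form needed by route `ABC/DefiniteXi` (the Gross-pairing defect of
`ξ = Σ w_i φ_i²` is supported at `2` and `3` with bounded exponent).

## References

* M.-F. Vignéras, *Arithmétique des algèbres de quaternions*, LNM 800 (1980), Ch. V
  [VignerasLNM800].
* J. Voight, *Quaternion Algebras*, GTM 288 (2021), chs. 11, 32 [Voight2021].
-/

noncomputable section

open scoped Pointwise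

universe u

namespace Literature.NumberTheory.Automorphic

/-! ### Roots of unity of order `3` and `4` in a ring without zero divisors -/

section Ring

variable {R : Type*} [Ring R] [NoZeroDivisors R]

/-- A cube root of unity `x ≠ 1` in a ring without zero divisors satisfies `x² + x + 1 = 0`.
[folklore] -/
theorem sq_add_self_add_one_eq_zero_of_pow_three {x : R} (h3 : x ^ 3 = 1) (h1 : x ≠ 1) :
    x ^ 2 + x + 1 = 0 := by
  have h : (x - 1) * (x ^ 2 + x + 1) = 0 := by
    have e : (x - 1) * (x ^ 2 + x + 1) = x ^ 3 - 1 := by noncomm_ring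
    rw [e, h3, sub_self]
  exact (mul_eq_zero.mp h).resolve_left (sub_ne_zero.mpr h1)

/-- Two commuting cube roots of unity `x, y ≠ 1` in a ring without zero divisors: `y = x` or
`y = x²` (`(y − x)(y − x²) = y² + y + 1 = 0`). [folklore] -/
theorem eq_or_eq_sq_of_pow_three {x y : R} (hx3 : x ^ 3 = 1) (hx1 : x ≠ 1) (hy3 : y ^ 3 = 1)
    (hy1 : y ≠ 1) (hc : Commute x y) : y = x ∨ y = x ^ 2 := by
  have hx := sq_add_self_add_one_eq_zero_of_pow_three hx3 hx1
  have hy := sq_add_self_add_one_eq_zero_of_pow_three hy3 hy1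
  have hc2 : x ^ 2 * y = y * x ^ 2 := (hc.pow_left 2).eq
  have h : (y - x) * (y - x ^ 2) = 0 := by
    have e : (y - x) * (y - x ^ 2) =
        (y ^ 2 + y + 1) - (x ^ 2 + x + 1) * y + (x ^ 3 - 1) + (x ^ 2 * y - y * x ^ 2) := by
      noncomm_ring
    rw [e, hx, hy, hx3, hc2]
    simp
  rcases mul_eq_zero.mp h with h | h
  · exact Or.inl (sub_eq_zero.mp h)
  · exact Or.inr (sub_eq_zero.mp h)

/-- In a ring without zero divisors `x⁴ = 1` forces `x = 1`, `x = -1` or `x² = -1`. [folklore] -/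
theorem eq_or_eq_neg_or_sq_of_pow_four {x : R} (h4 : x ^ 4 = 1) :
    x = 1 ∨ x = -1 ∨ x ^ 2 = -1 := by
  have h : (x - 1) * (x + 1) * (x ^ 2 + 1) = 0 := by
    have e : (x - 1) * (x + 1) * (x ^ 2 + 1) = x ^ 4 - 1 := by noncomm_ring
    rw [e, h4, sub_self]
  rcases mul_eq_zero.mp h with h | h
  · rcases mul_eq_zero.mp h with h | h
    · exact Or.inl (sub_eq_zero.mp h)
    · exact Or.inr (Or.inl (eq_neg_of_add_eq_zero_left h))
  · exact Or.inr (Or.inr (eq_neg_of_add_eq_zero_left h))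

/-- Two commuting square roots of `-1` in a ring without zero divisors agree up to sign.
[folklore] -/
theorem eq_or_eq_neg_of_sq_eq_neg_one {z w : R} (hz : z ^ 2 = -1) (hw : w ^ 2 = -1)
    (hc : Commute z w) : z = w ∨ z = -w := by
  have h : (z - w) * (z + w) = 0 := by
    have e : (z - w) * (z + w) = z ^ 2 - w ^ 2 + (z * w - w * z) := by noncomm_ring
    rw [e, hz, hw, hc.eq]
    simp
  rcases mul_eq_zero.mp h with h | h
  · exact Or.inl (sub_eq_zero.mp h)
  · exact Or.inr (eq_neg_of_add_eq_zero_left h)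

omit [NoZeroDivisors R] in
/-- Two square roots `x, y` of `-1` whose product is `±1` or again a square root of `-1` are equal
up to sign or anticommute (any ring). [folklore] -/
theorem anticomm_of_sq_eq_neg_one {x y : R} (hx : x ^ 2 = -1) (hy : y ^ 2 = -1)
    (hxy : x * y = 1 ∨ x * y = -1 ∨ (x * y) ^ 2 = -1) :
    y = x ∨ y = -x ∨ x * y = -(y * x) := by
  have hxx : x * x = -1 := by rw [← sq, hx]
  have hyy : y * y = -1 := by rw [← sq, hy]
  have e0 : x * (x * y) = -y := by rw [← mul_assoc, hxx, neg_one_mul]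
  rcases hxy with h | h | h
  · right; left
    rw [h, mul_one] at e0
    rw [e0, neg_neg]
  · left
    rw [h, mul_neg_one] at e0
    exact (neg_injective e0).symm
  · right; right
    have e1 : x * x * (y * x * y) = -x := by
      have e : x * x * (y * x * y) = x * (x * y) ^ 2 := by noncomm_ring
      rw [e, h, mul_neg_one]
    rw [hxx, neg_one_mul, neg_inj] at e1
    have e2 : y * y * (x * y) = y * x := by
      have e : y * y * (x * y) = y * (y * x * y) := by noncomm_ring
      rw [e, e1]
    rw [hyy, neg_one_mul] at e2
    rw [← e2, neg_neg]

omit [NoZeroDivisors R] in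
/-- An element anticommuting with `x` and with `y` commutes with `x y` (any ring). [folklore] -/
theorem commute_mul_of_anticomm {x y z : R} (hxz : x * z = -(z * x)) (hyz : y * z = -(z * y)) :
    Commute z (x * y) := by
  have hzx : z * x = -(x * z) := by rw [hxz, neg_neg]
  have hzy : z * y = -(y * z) := by rw [hyz, neg_neg]
  show z * (x * y) = x * y * z
  calc z * (x * y) = z * x * y := (mul_assoc z x y).symm
    _ = -(x * (z * y)) := by rw [hzx, neg_mul, mul_assoc]
    _ = x * y * z := by rw [hzy, mul_neg, neg_neg, mul_assoc]

omit [NoZeroDivisors R] in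
/-- The product of two anticommuting square roots of `-1` is a square root of `-1` (any ring).
[folklore] -/
theorem mul_sq_eq_neg_one_of_anticomm {x y : R} (hx : x ^ 2 = -1) (hy : y ^ 2 = -1)
    (h : x * y = -(y * x)) : (x * y) ^ 2 = -1 := by
  have hyx : y * x = -(x * y) := by rw [h, neg_neg]
  calc (x * y) ^ 2 = x * (y * x) * y := by noncomm_ring
    _ = -(x ^ 2 * y ^ 2) := by rw [hyx]; noncomm_ring
    _ = -1 := by rw [hx, hy]; noncomm_ring

end Ring

/-! ### Finite subgroups of `Rˣ` of exponent dividing `12` have order dividing `24` -/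

section Group

variable {R : Type*} [Ring R] [NoZeroDivisors R] {G : Type*} [Group G]

/-- An injection into a finset bounds `Nat.card` of the source by the size of the finset.
[folklore] -/
theorem natCard_le_card_of_forall_mem {α β : Type*} {F : α → β} (hF : Function.Injective F)
    (T : Finset β) (hT : ∀ a, F a ∈ T) : Nat.card α ≤ T.card := by
  have h := Nat.card_le_card_of_injective (fun a => (⟨F a, hT a⟩ : T))
    fun a b hab => hF (congrArg Subtype.val hab)
  rwa [Nat.card_eq_finsetCard] at h

/-- A commutative group of exponent `3` embedded in the units of a ring without zero divisors and
containing some `x ≠ 1` has at most `3` elements (namely `1, x, x²`). [folklore] -/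
theorem natCard_le_three_of_pow_three (f : G →* Rˣ) (hf : Function.Injective f)
    (h3 : ∀ g : G, g ^ 3 = 1) (hcomm : ∀ a b : G, a * b = b * a) {x : G} (hx : x ≠ 1) :
    Nat.card G ≤ 3 := by
  classical
  have hval3 : ∀ g : G, (f g : R) ^ 3 = 1 := fun g => by
    rw [← Units.val_pow_eq_pow_val, ← map_pow, h3, map_one, Units.val_one]
  have hne : ∀ {g : G}, g ≠ 1 → (f g : R) ≠ 1 := fun hg h =>
    hg (hf ((Units.val_eq_one.mp h).trans (map_one f).symm))
  have hinj : Function.Injective fun g => (f g : R) := fun a b hab => hf (Units.ext hab)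
  refine (natCard_le_card_of_forall_mem hinj [(1 : R), f x, (f x : R) ^ 2].toFinset
    fun g => ?_).trans ((List.toFinset_card_le _).trans (by simp))
  rw [List.mem_toFinset]
  by_cases hg : g = 1
  · simp [hg]
  · have hc : Commute (f x : R) (f g) := by
      show (f x : R) * f g = f g * f x
      rw [← Units.val_mul, ← map_mul, hcomm, map_mul, Units.val_mul]
    rcases eq_or_eq_sq_of_pow_three (hval3 x) (hne hx) (hval3 g) (hne hg) hc with h | h
    · simp [h]
    · simp [h]

/-- A group embedded in the units of a ring without zero divisors whose elements satisfy
`g¹² = 1` does not have order `9` (it would be commutative of exponent `3`). [folklore] -/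
theorem natCard_ne_nine_of_pow_twelve (f : G →* Rˣ) (hf : Function.Injective f)
    (h12 : ∀ g : G, g ^ 12 = 1) : Nat.card G ≠ 9 := by
  intro h9
  haveI : Finite G := Nat.finite_of_card_ne_zero (by rw [h9]; norm_num)
  have hcomm := (IsPGroup.isMulCommutative_of_card_eq_prime_sq (p := 3) (G := G)
    (by rw [h9]; norm_num)).is_comm.comm
  haveI : Nontrivial G := Finite.one_lt_card_iff_nontrivial.mp (by rw [h9]; norm_num)
  obtain ⟨x, hx⟩ := exists_ne (1 : G)
  have h3 : ∀ g : G, g ^ 3 = 1 := fun g => by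
    have h1 : orderOf g ∣ 9 := h9 ▸ orderOf_dvd_natCard g
    have h2 : orderOf g ∣ 12 := orderOf_dvd_of_pow_eq_one (h12 g)
    exact orderOf_dvd_iff_pow_eq_one.mp ((Nat.dvd_gcd h1 h2).trans (by decide))
  have := natCard_le_three_of_pow_three f hf h3 hcomm hx
  omega

/-- A group of exponent dividing `4` embedded in the units of a ring without zero divisors has at
most `8` elements: they are among `±1, ±x, ±y, ±xy` for square roots `x, y` of `-1`. [folklore] -/
theorem natCard_le_eight_of_pow_four (f : G →* Rˣ) (hf : Function.Injective f)
    (h4 : ∀ g : G, g ^ 4 = 1) : Nat.card G ≤ 8 := by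
  classical
  have hval4 : ∀ g : G, (f g : R) ^ 4 = 1 := fun g => by
    rw [← Units.val_pow_eq_pow_val, ← map_pow, h4, map_one, Units.val_one]
  have tri : ∀ g : G, (f g : R) = 1 ∨ (f g : R) = -1 ∨ (f g : R) ^ 2 = -1 := fun g =>
    eq_or_eq_neg_or_sq_of_pow_four (hval4 g)
  have hinj : Function.Injective fun g => (f g : R) := fun a b hab => hf (Units.ext hab)
  have key : ∀ a b : G, (f a : R) ^ 2 = -1 → (f b : R) ^ 2 = -1 →
      (f b : R) = f a ∨ (f b : R) = -f a ∨ (f a : R) * f b = -(f b * f a) := fun a b ha hb =>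
    anticomm_of_sq_eq_neg_one ha hb (by rw [← Units.val_mul, ← map_mul]; exact tri (a * b))
  by_cases hx : ∃ x : G, (f x : R) ^ 2 = -1
  · obtain ⟨x, hx⟩ := hx
    by_cases hy : ∃ y : G, (f y : R) ^ 2 = -1 ∧ (f y : R) ≠ f x ∧ (f y : R) ≠ -f x
    · obtain ⟨y, hy, hyx, hyx'⟩ := hy
      have hxy : (f x : R) * f y = -(f y * f x) :=
        ((key x y hx hy).resolve_left hyx).resolve_left hyx'
      have hxy2 : ((f x : R) * f y) ^ 2 = -1 := mul_sq_eq_neg_one_of_anticomm hx hy hxy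
      refine (natCard_le_card_of_forall_mem hinj
        [(1 : R), -1, f x, -f x, f y, -f y, f x * f y, -(f x * f y)].toFinset fun g => ?_).trans
        ((List.toFinset_card_le _).trans (by simp))
      rw [List.mem_toFinset]
      rcases tri g with h | h | h
      · simp [h]
      · simp [h]
      rcases key x g hx h with h1 | h1 | h1
      · simp [h1]
      · simp [h1]
      rcases key y g hy h with h2 | h2 | h2
      · simp [h2]
      · simp [h2]
      rcases eq_or_eq_neg_of_sq_eq_neg_one h hxy2 (commute_mul_of_anticomm h1 h2) with h3 | h3
      · simp [h3]
      · simp [h3]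
    · push Not at hy
      refine (natCard_le_card_of_forall_mem hinj [(1 : R), -1, f x, -f x].toFinset
        fun g => ?_).trans ((List.toFinset_card_le _).trans (by simp))
      rw [List.mem_toFinset]
      rcases tri g with h | h | h
      · simp [h]
      · simp [h]
      by_cases h1 : (f g : R) = f x
      · simp [h1]
      · simp [hy g h h1]
  · push Not at hx
    refine (natCard_le_card_of_forall_mem hinj [(1 : R), -1].toFinset fun g => ?_).trans
      ((List.toFinset_card_le _).trans (by simp))
    rw [List.mem_toFinset]
    rcases tri g with h | h | h
    · simp [h]
    · simp [h]
    · exact absurd h (hx g)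

/-- **A finite group embedded in the units of a ring without zero divisors all of whose elements
satisfy `g¹² = 1` has order dividing `24`** (Cauchy: only `2, 3` divide the order; Sylow: no
subgroup of order `16` or `9`). [folklore] -/
theorem natCard_dvd_twentyfour_of_pow_twelve [Finite G] (f : G →* Rˣ) (hf : Function.Injective f)
    (h12 : ∀ g : G, g ^ 12 = 1) : Nat.card G ∣ 24 := by
  refine (Nat.dvd_iff_prime_pow_dvd_dvd 24 (Nat.card G)).mpr fun p k hp hpk => ?_
  rcases Nat.eq_zero_or_pos k with rfl | hk
  · simp
  haveI : Fact p.Prime := ⟨hp⟩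
  have hpG : p ∣ Nat.card G := (dvd_pow_self p hk.ne').trans hpk
  obtain ⟨g, hg⟩ := exists_prime_orderOf_dvd_card' p hpG
  have hp12 : p ∣ 2 ^ 2 * 3 := hg ▸ orderOf_dvd_of_pow_eq_one (h12 g)
  have hp23 : p = 2 ∨ p = 3 := by
    rcases (Nat.Prime.dvd_mul hp).mp hp12 with h | h
    · exact Or.inl ((Nat.prime_dvd_prime_iff_eq hp Nat.prime_two).mp (hp.dvd_of_dvd_pow h))
    · exact Or.inr ((Nat.prime_dvd_prime_iff_eq hp Nat.prime_three).mp h)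
  have hsub : ∀ (K : Subgroup G) (u : K), u ^ 12 = 1 := fun K u => Subtype.ext (by simp [h12])
  rcases hp23 with rfl | rfl
  · -- no subgroup of order `16`
    have hk3 : k ≤ 3 := by
      by_contra hk4
      push Not at hk4
      obtain ⟨K, hK⟩ := Sylow.exists_subgroup_card_pow_prime 2 ((pow_dvd_pow 2 hk4).trans hpk)
      have hK4 : ∀ u : K, u ^ 4 = 1 := fun u => by
        have h1 : orderOf u ∣ 2 ^ 4 := hK ▸ orderOf_dvd_natCard u
        have h2 : orderOf u ∣ 12 := orderOf_dvd_of_pow_eq_one (hsub K u)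
        exact orderOf_dvd_iff_pow_eq_one.mp ((Nat.dvd_gcd h1 h2).trans (by decide))
      have h8 := natCard_le_eight_of_pow_four (f.comp K.subtype) (hf.comp K.subtype_injective) hK4
      rw [hK] at h8
      norm_num at h8
    exact (pow_dvd_pow 2 hk3).trans (by norm_num)
  · -- no subgroup of order `9`
    have hk1 : k ≤ 1 := by
      by_contra hk2
      push Not at hk2
      obtain ⟨K, hK⟩ := Sylow.exists_subgroup_card_pow_prime 3 ((pow_dvd_pow 3 hk2).trans hpk)
      exact natCard_ne_nine_of_pow_twelve (f.comp K.subtype) (hf.comp K.subtype_injective)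
        (hsub K) (by rw [hK]; norm_num)
    exact (pow_dvd_pow 3 hk1).trans (by norm_num)

end Group

/-! ### Unit groups of definite quaternion orders over `ℚ`; the Brandt weights divide `12` -/

namespace Brandt

variable {D : Type u} [Ring D] [Algebra ℚ D] [IsQuaternionAlgebra ℚ D]

/-- **`#O_L(I)ˣ = #Stab_{Dˣ}(I) ∣ 24`** for a full lattice `I` of a totally definite quaternion
algebra over `ℚ`: the stabiliser is finite (`finite_units_leftOrder`), its elements have order
dividing `12` (`orderOf_dvd_twelve_of_mem_stabilizer`), and `D` is a division algebra
(`isUnit_of_isTotallyDefinite`). [folklore] -/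
theorem card_stabilizer_dvd_twentyfour (hdef : IsTotallyDefinite ℚ D) {I : Submodule ℤ D}
    (hI : IsFullLattice D I) : Nat.card (MulAction.stabilizer Dˣ I) ∣ 24 := by
  haveI : NoZeroDivisors D :=
    noZeroDivisors_of_forall_isUnit fun x hx => isUnit_of_isTotallyDefinite D hdef hx
  obtain ⟨e⟩ := nonempty_stabilizerEquivUnits I
  have hfin : Finite {x : D // x ∈ leftOrder I ∧ ∃ y ∈ leftOrder I, x * y = 1 ∧ y * x = 1} :=
    (finite_units_leftOrder hdef hI).to_subtype
  haveI : Finite (MulAction.stabilizer Dˣ I) := Finite.of_equiv _ e.symm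
  refine natCard_dvd_twentyfour_of_pow_twelve (MulAction.stabilizer Dˣ I).subtype
    (Subgroup.subtype_injective _) fun u => ?_
  have h := orderOf_dvd_twelve_of_mem_stabilizer hdef hI u.2
  rw [Subgroup.orderOf_coe] at h
  exact orderOf_dvd_iff_pow_eq_one.mp h

/-- **`w(O_L I) = #O_L(I)ˣ / 2 ∣ 12`** for a full lattice `I` of a totally definite quaternion
algebra over `ℚ` (`#Stab(I) = 2 · unitIndex (O_L I)`, `card_stabilizer_eq_two_mul_unitIndex`).
[folklore] -/
theorem unitIndex_leftOrder_dvd_twelve (hdef : IsTotallyDefinite ℚ D) {I : Submodule ℤ D}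
    (hI : IsFullLattice D I) : unitIndex (leftOrder I) ∣ 12 := by
  have h := card_stabilizer_dvd_twentyfour hdef hI
  rw [card_stabilizer_eq_two_mul_unitIndex one_ne_neg_one_rat, show (24 : ℕ) = 2 * 12 from rfl] at h
  exact (mul_dvd_mul_iff_left two_ne_zero).mp h

/-- **The Brandt weights divide `12`: `weight O c = #O_L(I_c)ˣ / 2 ∣ 12`** for any order datum `O`
of a totally definite quaternion algebra over `ℚ` (the classes consist of full lattices).
[folklore] -/
theorem weight_dvd_twelve (hdef : IsTotallyDefinite ℚ D) (O : Submodule ℤ D) (c : ClassSet O) :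
    weight O c ∣ 12 :=
  unitIndex_leftOrder_dvd_twelve hdef c.rep_mem.1

/-- **`w_c ∣ 12` for the weights of a Brandt setup of type `(N⁺, N⁻)`.** [folklore] -/
theorem XiSetup.weight_dvd_twelve {Nplus Nminus : ℕ} (S : XiSetup Nplus Nminus)
    (c : ClassSet S.O) : weight S.O c ∣ 12 :=
  Brandt.weight_dvd_twelve S.isTotallyDefinite S.O c

end Brandt

end Literature.NumberTheory.Automorphic

end
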